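import Mathlib.Analysis.Convex.Combination
import Mathlib.LinearAlgebra.Basis.VectorSpace
import Mathlib.LinearAlgebra.AffineSpace.Independent
import Mathlib.LinearAlgebra.Pi
import Literature.ModelTheory.ExponentialFields.Semialgebraic
import HarnessLib

/-!
# Simplices are semialgebraic

The closed geometric simplex spanned by an affinely independent family `v : Fin (k+1) → ℝᵈ`
(`convexHull ℝ (range v)`) is an `ℝ`-semialgebraic subset of `ℝᵈ`, *without* Tarski–Seidenberg:
affine independence gives a linear left inverse of `w ↦ (∑ wᵢ vᵢ, ∑ wᵢ)`, hence an affine map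
`Λ : ℝᵈ → ℝᵏ⁺¹` recovering the barycentric coordinates on the simplex, and then
`convexHull (range v) = {x | Λ x ≥ 0, ∑ Λ x = 1, ∑ (Λ x)ᵢ vᵢ = x}` is cut out by finitely many affine
(= degree-one polynomial) equations and inequalities [BochnakCosteRoy1998, §2.1 (polyhedra are the basic
examples of semialgebraic sets)]. Consequence used downstream
(`Literature.Barriers.KontsevichZagierPeriods.HauptvermutungObstructionProofs`): compact polyhedra are
semialgebraic, so the hypothesis of the semialgebraic Hauptvermutung is satisfiable (e.g. by the identity).

## Main statements (all proved)

* `affinePoly L c`, `aeval_affinePoly` — the degree-one polynomial computing `x ↦ L x + c` for a linear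
  functional `L` on `ℝᵈ`.
* `isSemialgebraic_setOf_affine_eq_zero`, `isSemialgebraic_setOf_affine_nonneg` — `{L x + c = 0}`,
  `{0 ≤ L x + c}` are semialgebraic.
* `mem_convexHull_range_iff_exists_weights` — membership in the simplex via nonnegative weights summing
  to one (all of `Fin (k+1)`).
* `exists_linear_barycentric` — a linear `G : ℝᵈ × ℝ → ℝᵏ⁺¹` with `G (∑ wᵢ vᵢ, ∑ wᵢ) = w`.
* `isSemialgebraic_convexHull_of_affineIndependent` — the simplex is `ℝ`-semialgebraic.

## References

* [BochnakCosteRoy1998] J. Bochnak, M. Coste, M.-F. Roy, *Real Algebraic Geometry* (1998), §2.1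
  (definition and first examples of semialgebraic sets; cited for context, the argument here is
  elementary linear algebra). [folklore]
-/

noncomputable section

open Set MvPolynomial

namespace Literature.ModelTheory.ExponentialFields

variable {d : ℕ}

/-! ### Affine functionals are polynomial -/

/-- The degree-one polynomial `∑ₗ L(eₗ) · Xₗ + c` that computes the affine functional `x ↦ L x + c`
on `ℝᵈ`. [folklore] -/
def affinePoly (L : (Fin d → ℝ) →ₗ[ℝ] ℝ) (c : ℝ) : MvPolynomial (Fin d) ℝ :=
  ∑ l : Fin d, C (L (Pi.single l 1)) * X l + C c

/-- `affinePoly L c` evaluates to `L x + c`. [folklore] -/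
theorem aeval_affinePoly (L : (Fin d → ℝ) →ₗ[ℝ] ℝ) (c : ℝ) (x : Fin d → ℝ) :
    aeval x (affinePoly L c) = L x + c := by
  simp only [affinePoly, map_add, map_sum, map_mul, aeval_C, aeval_X, Algebra.algebraMap_self,
    RingHom.id_apply]
  congr 1
  rw [LinearMap.pi_apply_eq_sum_univ L x]
  refine Finset.sum_congr rfl fun l _ => ?_
  rw [smul_eq_mul, mul_comm]
  congr 2
  ext j
  simp only [Pi.single_apply]
  split_ifs with h₁ h₂ h₂
  · rfl
  · exact (h₂ h₁.symm).elim
  · exact (h₁ h₂.symm).elim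
  · rfl

/-- The zero set `{x | L x + c = 0}` of an affine functional is `ℝ`-semialgebraic. [folklore] -/
theorem isSemialgebraic_setOf_affine_eq_zero (L : (Fin d → ℝ) →ₗ[ℝ] ℝ) (c : ℝ) :
    IsSemialgebraic ℝ {x : Fin d → ℝ | L x + c = 0} := by
  convert isSemialgebraic_setOf_eval_eq_zero (k := ℝ) (R := ℝ) (affinePoly L c) using 1
  ext x
  rw [mem_setOf_eq, mem_setOf_eq, aeval_affinePoly]

/-- The half-space `{x | 0 ≤ L x + c}` of an affine functional is `ℝ`-semialgebraic (union of the zero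
set and the positivity set). [folklore] -/
theorem isSemialgebraic_setOf_affine_nonneg (L : (Fin d → ℝ) →ₗ[ℝ] ℝ) (c : ℝ) :
    IsSemialgebraic ℝ {x : Fin d → ℝ | 0 ≤ L x + c} := by
  have h : {x : Fin d → ℝ | 0 ≤ L x + c} =
      {x | aeval x (affinePoly L c) = 0} ∪ {x | 0 < aeval x (affinePoly L c)} := by
    ext x
    simp only [mem_setOf_eq, mem_union, aeval_affinePoly]
    constructor
    · intro hx
      rcases hx.lt_or_eq with hlt | heq
      exacts [Or.inr hlt, Or.inl heq.symm]
    · rintro (hx | hx)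
      exacts [hx.ge, hx.le]
  rw [h]
  exact (isSemialgebraic_setOf_eval_eq_zero _).union (isSemialgebraic_setOf_eval_pos _)

/-! ### Barycentric coordinates of an affinely independent family -/

section Simplex

variable {k : ℕ} (v : Fin (k + 1) → (Fin d → ℝ))

/-- Membership in the simplex spanned by `v` via nonnegative weights on all of `Fin (k+1)` summing to
one. [folklore] -/
theorem mem_convexHull_range_iff_exists_weights {x : Fin d → ℝ} :
    x ∈ convexHull ℝ (range v) ↔
      ∃ w : Fin (k + 1) → ℝ, (∀ i, 0 ≤ w i) ∧ ∑ i, w i = 1 ∧ ∑ i, w i • v i = x := by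
  constructor
  · intro hx
    rw [convexHull_range_eq_exists_affineCombination] at hx
    obtain ⟨s, w, hw₀, hw₁, rfl⟩ := hx
    refine ⟨Set.indicator (↑s) w, fun i => ?_, ?_, ?_⟩
    · by_cases hi : i ∈ s
      · rw [Set.indicator_of_mem (Finset.mem_coe.2 hi)]
        exact hw₀ i hi
      · rw [Set.indicator_of_notMem (fun h => hi (Finset.mem_coe.1 h))]
    · rw [Finset.sum_indicator_subset w (Finset.subset_univ s), hw₁]
    · have h1 : ∑ i, Set.indicator (↑s) w i = 1 := by
        rw [Finset.sum_indicator_subset w (Finset.subset_univ s), hw₁]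
      rw [← Finset.affineCombination_eq_linear_combination _ _ _ h1,
        ← Finset.affineCombination_indicator_subset w v (Finset.subset_univ s)]
  · rintro ⟨w, hw₀, hw₁, rfl⟩
    rw [← Finset.affineCombination_eq_linear_combination _ _ _ hw₁]
    exact affineCombination_mem_convexHull (fun i _ => hw₀ i) hw₁

variable {v}

/-- For an affinely independent `v` there is a linear `G : ℝᵈ × ℝ → ℝᵏ⁺¹` with
`G (∑ wᵢ vᵢ, ∑ wᵢ) = w` for all weights `w`: the linear map `w ↦ (∑ wᵢ vᵢ, ∑ wᵢ)` is injective by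
affine independence, so it has a linear left inverse. [folklore] -/
theorem exists_linear_barycentric (hv : AffineIndependent ℝ v) :
    ∃ G : (Fin d → ℝ) × ℝ →ₗ[ℝ] (Fin (k + 1) → ℝ),
      ∀ w : Fin (k + 1) → ℝ, G (∑ i, w i • v i, ∑ i, w i) = w := by
  let F : (Fin (k + 1) → ℝ) →ₗ[ℝ] (Fin d → ℝ) × ℝ :=
    LinearMap.prod (Fintype.linearCombination ℝ v) (Fintype.linearCombination ℝ fun _ => (1 : ℝ))
  have hF : ∀ w, F w = (∑ i, w i • v i, ∑ i, w i) := fun w => by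
    simp [F, Fintype.linearCombination_apply]
  have hker : LinearMap.ker F = ⊥ := by
    rw [LinearMap.ker_eq_bot']
    intro w hw
    rw [hF, Prod.mk_eq_zero] at hw
    have h0 : ∀ i ∈ (Finset.univ : Finset (Fin (k + 1))), w i = 0 := by
      refine hv Finset.univ w hw.2 ?_
      rw [Finset.weightedVSub_eq_linear_combination _ hw.2]
      exact hw.1
    exact funext fun i => h0 i (Finset.mem_univ i)
  obtain ⟨G, hG⟩ := F.exists_leftInverse_of_injective hker
  refine ⟨G, fun w => ?_⟩
  rw [← hF]
  exact LinearMap.congr_fun hG w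

/-- **A simplex is semialgebraic.** The closed simplex `convexHull (range v)` spanned by an affinely
independent family `v : Fin (k+1) → ℝᵈ` is an `ℝ`-semialgebraic subset of `ℝᵈ`: with `G` as in
`exists_linear_barycentric` and `Λ x = G (x, 1)`, it equals
`{x | ∀ i, 0 ≤ Λ x i} ∩ {x | ∑ Λ x i = 1} ∩ ⋂ₗ {x | ∑ᵢ Λ x i · vᵢ l = x l}`, a finite Boolean
combination of affine (in)equalities. [folklore] -/
theorem isSemialgebraic_convexHull_of_affineIndependent (hv : AffineIndependent ℝ v) :
    IsSemialgebraic ℝ (convexHull ℝ (range v)) := by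
  obtain ⟨G, hG⟩ := exists_linear_barycentric hv
  -- the affine coordinate functionals `x ↦ G (x, 1) i = Lᵢ x + cᵢ`
  let L : Fin (k + 1) → (Fin d → ℝ) →ₗ[ℝ] ℝ := fun i =>
    (LinearMap.proj i).comp (G.comp (LinearMap.inl ℝ (Fin d → ℝ) ℝ))
  let c : Fin (k + 1) → ℝ := fun i => G (0, 1) i
  have hΛ : ∀ (x : Fin d → ℝ) (i : Fin (k + 1)), G (x, 1) i = L i x + c i := by
    intro x i
    have : ((x, 1) : (Fin d → ℝ) × ℝ) = (x, 0) + (0, 1) := by simp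
    rw [this, map_add]
    rfl
  -- the three families of conditions
  let S₁ : Set (Fin d → ℝ) := ⋂ i ∈ (Finset.univ : Finset (Fin (k + 1))), {x | 0 ≤ L i x + c i}
  let S₂ : Set (Fin d → ℝ) := {x | (∑ i, L i : (Fin d → ℝ) →ₗ[ℝ] ℝ) x + (∑ i, c i - 1) = 0}
  let S₃ : Set (Fin d → ℝ) := ⋂ l ∈ (Finset.univ : Finset (Fin d)),
    {x | (∑ i, v i l • L i - LinearMap.proj l : (Fin d → ℝ) →ₗ[ℝ] ℝ) x + ∑ i, c i * v i l = 0}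
  have h₁ : IsSemialgebraic ℝ S₁ :=
    IsSemialgebraic.biInter _ _ fun i _ => isSemialgebraic_setOf_affine_nonneg (L i) (c i)
  have h₂ : IsSemialgebraic ℝ S₂ := isSemialgebraic_setOf_affine_eq_zero _ _
  have h₃ : IsSemialgebraic ℝ S₃ :=
    IsSemialgebraic.biInter _ _ fun l _ => isSemialgebraic_setOf_affine_eq_zero _ _
  convert (h₁.inter h₂).inter h₃ using 1
  ext x
  rw [mem_convexHull_range_iff_exists_weights]
  simp only [S₁, S₂, S₃, mem_inter_iff, mem_iInter, Finset.mem_univ, forall_true_left, mem_setOf_eq,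
    LinearMap.sum_apply, LinearMap.sub_apply, LinearMap.smul_apply,
    LinearMap.proj_apply, smul_eq_mul]
  constructor
  · -- a point of the simplex satisfies the conditions, its coordinates being `Λ x = w`
    rintro ⟨w, hw₀, hw₁, rfl⟩
    have hw : ∀ i, L i (∑ j, w j • v j) + c i = w i := fun i => by
      rw [← hΛ]
      have := congr_fun (hG w) i
      rwa [hw₁] at this
    refine ⟨⟨fun i => (hw i).symm ▸ hw₀ i, ?_⟩, fun l => ?_⟩
    · have : ∑ i, (L i (∑ j, w j • v j) + c i) = 1 := by simp_rw [hw]; exact hw₁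
      rw [Finset.sum_add_distrib] at this
      linarith
    · have hsum : ∑ i, v i l * (L i (∑ j, w j • v j)) + ∑ i, c i * v i l =
          ∑ i, w i * v i l := by
        rw [← Finset.sum_add_distrib]
        refine Finset.sum_congr rfl fun i _ => ?_
        rw [← hw i]
        ring
      have hx : (∑ j, w j • v j) l = ∑ i, w i * v i l := by
        simp [Finset.sum_apply, Pi.smul_apply, smul_eq_mul]
      linarith
  · -- conversely the coordinates `Λ x` are admissible weights reproducing `x`
    rintro ⟨⟨h0, hs⟩, hl⟩
    refine ⟨fun i => L i x + c i, h0, ?_, ?_⟩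
    · rw [Finset.sum_add_distrib]
      linarith
    · ext l
      have hl' := hl l
      have hx : (∑ i, (L i x + c i) • v i) l = ∑ i, (L i x + c i) * v i l := by
        simp [Finset.sum_apply, Pi.smul_apply, smul_eq_mul]
      rw [hx]
      have : ∑ i, (L i x + c i) * v i l = ∑ i, v i l * L i x + ∑ i, c i * v i l := by
        rw [← Finset.sum_add_distrib]
        exact Finset.sum_congr rfl fun i _ => by ring
      linarith

end Simplex

end Literature.ModelTheory.ExponentialFields
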